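import Mathlib.Algebra.BigOperators.Group.Finset.Basic
import Mathlib.Algebra.BigOperators.Ring.Finset
import Mathlib.Algebra.Module.Basic
import Mathlib.Data.Nat.Choose.Basic
import Mathlib.Data.Nat.Prime.Basic
import Mathlib.Tactic.Ring
import HarnessLib

/-!
# Higher (Darmon–Kolyvagin) derivative operators: Ota 2018, Lemma 3.1

Companion to `HeegnerPointsKolyvaginDerivativeProofs` (Kolyvagin's first derivative
`D = ∑_{i<m} i σ^i` and Gross 1991, (3.5)). Here: the **higher derivatives**
`D^{(k)} = ∑_{i<m} C(i,k) σ^i` of Darmon 1992 / Ota 2018 §3.1 (`D^{(0)} = Tr`, `D^{(1)} = D`), the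
group-ring identity behind every "higher-order Kolyvagin class", and the divisibility that makes the
`(k+1)`-st derivative class Galois-invariant modulo `q` as soon as the `k`-th one vanishes modulo `q`.
Everything here is **proved**; pure algebra, no definition, no named fact (D-0026).

Ota, Amer. J. Math. 140 (2018), §3.1 (arXiv:1509.00682 p. 6), verbatim: *"For an element
`σ ∈ Γ_S` of order `n` and for an integer `k ≥ 0`, we define `D_σ^{(k)} = ∑_{j=0}^{n-1} C(j,k) σ^j ∈ ℤ[Γ_S]`.
… **Lemma 3.1.** If `σ ∈ Γ_S` is of order `n` and `1 ≤ k ≤ n − 1`, then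
`(σ − 1) D_σ^{(k)} = C(n,k) − σ D_σ^{(k−1)}`. In particular, if `n` is a power `q` of `p` and
`0 < k < p`, then we have `(σ − 1) D_σ^{(k)} ≡ −σ D_σ^{(k−1)} mod q`. Proof. This is proved by a
straightforward computation. For the second assertion, note that `C(q,k) ≡ 0 mod q` when
`0 < k < p`."*

* `sub_one_mul_sum_choose_succ_mul_pow` — in a commutative ring, with NO hypothesis on `σ`:
  `(σ − 1) ∑_{i<m} C(i,k+1) σ^i = C(m,k+1) σ^m − σ ∑_{i<m} C(i,k) σ^i` (telescoping by Pascal's rule;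
  this unconditional form is the one used for a LIFT `σ` of the generator to the absolute Galois
  group, where `σ^m ≠ 1`);
* `sub_one_mul_higherDerivative` — **Ota 2018, Lemma 3.1**: if `σ^m = 1` then
  `(σ − 1) D^{(k+1)} = C(m,k+1) − σ D^{(k)}`;
* `pow_dvd_choose_of_pow_dvd_of_lt` — if `p` is prime, `p^a ∣ m` and `0 < k < p` then
  `p^a ∣ C(m,k)` (Ota's "second assertion", for any `m`, not only `m = q`);
* `exists_sub_one_smul_higherDerivative_smul_eq` — **the Bockstein step**: on a module, if `σ^m = 1`,
  `q ∣ C(m,k+1)` and `D^{(k)} • y ∈ q M`, then `(σ − 1) • D^{(k+1)} • y ∈ q M` — the class of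
  `D^{(k+1)} y` modulo `q` is fixed by `σ` as soon as the class of `D^{(k)} y` vanishes modulo `q`
  (for `k = 0`: `D^{(0)} = Tr`, and this is Gross 1991, Prop. 3.6 / `exists_sub_one_smul_kolyvaginDerivative_smul_eq`);
* `sum_choose_zero_mul_pow`, `sum_choose_one_mul_pow` — `D^{(0)} = Tr` and `D^{(1)} = D`, linking to
  the notation of `HeegnerPointsKolyvaginDerivativeProofs`.

## References

* K. Ota, *Kato's Euler system and the Mazur–Tate refined conjecture of BSD type*, Amer. J. Math.
  140 (2018) 495–542, §3.1, Lemma 3.1 (held `paper:arxiv-1509.00682`, p. 6). [Ota2018]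
* H. Darmon, *A refined conjecture of Mazur–Tate type for Heegner points*, Invent. Math. 110
  (1992) 123–146 (the derivatives `D^{(k)}`). [cite-only]
* B. H. Gross, *Kolyvagin's work on modular elliptic curves* (1991), §3 (3.5), Prop. 3.6 — the case
  `k = 0`. [GrossLMS1991]
-/

open Finset

namespace Literature.NumberTheory.EllipticCurves

namespace KolyvaginDerivative

section CommRing

variable {R : Type*} [CommRing R]

/-- In any commutative ring, with no hypothesis on `σ`:
`(σ − 1) ∑_{i<m} C(i,k+1) σ^i = C(m,k+1) σ^m − σ ∑_{i<m} C(i,k) σ^i` (telescoping via Pascal's rule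
`C(i+1,k+1) = C(i,k) + C(i,k+1)`). [cite: Ota2018, Lemma 3.1 (proof)] -/
theorem sub_one_mul_sum_choose_succ_mul_pow (σ : R) (m k : ℕ) :
    (σ - 1) * ∑ i ∈ range m, ((i.choose (k + 1) : ℕ) : R) * σ ^ i =
      ((m.choose (k + 1) : ℕ) : R) * σ ^ m - σ * ∑ i ∈ range m, ((i.choose k : ℕ) : R) * σ ^ i := by
  induction m with
  | zero => simp
  | succ m ih =>
    rw [sum_range_succ, mul_add, ih, sum_range_succ, Nat.choose_succ_succ]
    push_cast
    ring

/-- **Ota 2018, Lemma 3.1: `(σ − 1) D^{(k+1)} = C(m,k+1) − σ D^{(k)}`** for the Darmon–Kolyvagin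
derivatives `D^{(k)} = ∑_{i<m} C(i,k) σ^i` of an element `σ` with `σ^m = 1` in a commutative ring
(the group ring `ℤ[Γ_S]`). [cite: Ota2018, Lemma 3.1] -/
theorem sub_one_mul_higherDerivative {σ : R} {m : ℕ} (hσ : σ ^ m = 1) (k : ℕ) :
    (σ - 1) * ∑ i ∈ range m, ((i.choose (k + 1) : ℕ) : R) * σ ^ i =
      ((m.choose (k + 1) : ℕ) : R) - σ * ∑ i ∈ range m, ((i.choose k : ℕ) : R) * σ ^ i := by
  rw [sub_one_mul_sum_choose_succ_mul_pow, hσ, mul_one]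

/-- `D^{(0)} = Tr`: `∑_{i<m} C(i,0) σ^i = ∑_{i<m} σ^i` (Ota 2018 §3.1: `D_σ^{(0)}` is the trace
element, *"We put `C(j,0) = 1` for `j ≥ 0`"*). [cite: Ota2018, §3.1 (definition of D_σ^{(k)})] -/
theorem sum_choose_zero_mul_pow (σ : R) (m : ℕ) :
    ∑ i ∈ range m, ((i.choose 0 : ℕ) : R) * σ ^ i = ∑ i ∈ range m, σ ^ i := by
  simp

/-- `D^{(1)} = D`: `∑_{i<m} C(i,1) σ^i = ∑_{i<m} i σ^i`, Kolyvagin's derivative of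
`HeegnerPointsKolyvaginDerivativeProofs` (Ota 2018 §3.1: `D_σ^{(1)}` is Kolyvagin's `D_σ`).
[cite: Ota2018, §3.1 (definition of D_σ^{(k)})] -/
theorem sum_choose_one_mul_pow (σ : R) (m : ℕ) :
    ∑ i ∈ range m, ((i.choose 1 : ℕ) : R) * σ ^ i = ∑ i ∈ range m, (i : R) * σ ^ i := by
  simp

end CommRing

section Choose

/-- **`p^a ∣ m` and `0 < k < p` imply `p^a ∣ C(m,k)`** (Ota 2018, Lemma 3.1, second assertion:
*"note that `C(q,k) ≡ 0 mod q` when `0 < k < p`"*, here for every `m` divisible by `q = p^a`):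
from `m · C(m−1,k−1) = C(m,k) · k` and `gcd(p^a, k) = 1`. [cite: Ota2018, Lemma 3.1] -/
theorem pow_dvd_choose_of_pow_dvd_of_lt {p a m k : ℕ} (hp : p.Prime) (hm : p ^ a ∣ m)
    (hk0 : 0 < k) (hkp : k < p) : p ^ a ∣ m.choose k := by
  obtain ⟨k, rfl⟩ := Nat.exists_eq_succ_of_ne_zero hk0.ne'
  rcases Nat.eq_zero_or_pos m with rfl | hm0
  · rw [Nat.choose_zero_succ]
    exact dvd_zero _
  obtain ⟨n, rfl⟩ := Nat.exists_eq_succ_of_ne_zero hm0.ne'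
  -- `(n+1) * C(n,k) = C(n+1,k+1) * (k+1)`
  have h := Nat.add_one_mul_choose_eq n k
  have hcop : Nat.Coprime (p ^ a) (k + 1) :=
    Nat.Coprime.pow_left a
      ((Nat.Prime.coprime_iff_not_dvd hp).mpr (Nat.not_dvd_of_pos_of_lt (Nat.succ_pos k) hkp))
  have hdvd : p ^ a ∣ (n + 1).choose (k + 1) * (k + 1) := by
    rw [← h]
    exact Dvd.dvd.mul_right hm _
  exact hcop.dvd_of_dvd_mul_right hdvd

end Choose

section Module

variable {R : Type*} [CommRing R] {M : Type*} [AddCommGroup M] [Module R M]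

/-- **The Bockstein step for higher Kolyvagin classes.** Let `R` be a commutative ring (`ℤ[Γ]`)
acting on `M` (`E(K_n)`, or `H¹(ℚ(n), T)`), `σ ∈ R` with `σ^m = 1`, `D^{(k)} = ∑_{i<m} C(i,k) σ^i`.
If `q ∣ C(m,k+1)` (e.g. `q = p^a ∣ m` and `k + 1 < p`, `pow_dvd_choose_of_pow_dvd_of_lt`) and the
`k`-th derivative class vanishes modulo `q`, `D^{(k)} • y = q • z`, then
`(σ − 1) • D^{(k+1)} • y = q • w` for some `w`: the class of `D^{(k+1)} y` modulo `q` is fixed by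
`σ`. For `k = 0` (`D^{(0)} = Tr`) this is the algebra of Gross 1991, Prop. 3.6. [cite: Ota2018, Lemma 3.1] -/
theorem exists_sub_one_smul_higherDerivative_smul_eq {σ : R} {m q : ℕ} (hσ : σ ^ m = 1) (k : ℕ)
    (hq : q ∣ m.choose (k + 1)) {y z : M}
    (hz : (∑ i ∈ range m, ((i.choose k : ℕ) : R) * σ ^ i) • y = (q : R) • z) :
    ∃ w : M, (σ - 1) • (∑ i ∈ range m, ((i.choose (k + 1) : ℕ) : R) * σ ^ i) • y = (q : R) • w := by
  obtain ⟨c, hc⟩ := hq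
  refine ⟨(c : R) • y - σ • z, ?_⟩
  rw [← mul_smul, sub_one_mul_higherDerivative hσ, sub_smul, mul_smul, hz, hc, Nat.cast_mul,
    mul_smul, smul_sub, smul_comm σ (q : R) z]

end Module

end KolyvaginDerivative

end Literature.NumberTheory.EllipticCurves
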